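import Mathlib
import HarnessLib
import Summits.Ventures.LatticeQCDFlow.Exactness.SUNWilsonHMCErgodic
import Summits.Ventures.LatticeQCDFlow.Exactness.DoeblinObservables
import Summits.Ventures.LatticeQCDFlow.Exactness.OpenBoundaryHMCForce
import Summits.Ventures.LatticeQCDFlow.Exactness.WeightedOverrelaxation
import Summits.Ventures.LatticeQCDFlow.Exactness.OpenBoundaryTranslation
import Summits.Ventures.LatticeQCDFlow.Scoring.TranslationAverageTwoPoint

/-!
# The two periodic arms of row 21 agree on every BOUNDED observable — in particular on the measured topological susceptibility `E[Q_m²]` — with explicit geometric rates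

HONEST FRAMING: exact (Metropolis-corrected) sampling algorithms for lattice gauge theory;
figures of merit are autocorrelation/cost numbers at stated couplings and volumes; no
continuum-physics claim.

Venture `LatticeQCDFlow` (cell pub-lqcd), topic `Exactness`, FANOUT row 21 (`su3-base`: acceptance (b)/(c) compare the flowed
charge and `χ_top = E[Q²]/V` measured by arm E1 = heat bath + over-relaxation and by arm E2 = the engine's HMC).  NEW WORK of the
cell, companion of row 21's `TwoArmsAgreement` (which treats `[0,1]`-valued observables): the affine rescaling that carries the
setwise (total-variation) envelopes of row 21's `SUNWilsonHMCErgodic` and row 9's `CabibboMarinariORSweep` to every measurable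
observable with values in a bounded interval `[a, b]`, and the instance that matters for the row — the SQUARE OF THE MEASURED
CHARGE `Q_m = Σ_x P_x ∘ RK3_{ε'}^m` (bounded on the compact configuration space).  Def-free; nothing is cited as a fact; no number.

* §1 `abs_integral_sub_integral_le_of_setwise_of_mem_Icc` — setwise closeness `δ` of two probability laws controls every
  measurable `g` with `a ≤ g ≤ b`: `|∫ g dμ − ∫ g dν| ≤ (b − a) δ` (from row 9's `[0,1]` lemma).
* §2 **`wilsonHmcRun_integral_sub_wilson_le_of_mem_Icc`** (HMC arm: `(b − a)(1 − δ)^{⌊t/(k+1)⌋}`) and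
  **`e1Run_integral_sub_wilson_le_of_mem_Icc`** (E1 arm: `(b − a)(1 − ε)^t`), every probability start, every step.
* §3 **`twoArms_integral_sub_le_of_mem_Icc`** — the two runs' expectations of every such `g` differ by at most
  `(b − a)((1 − δ)^{⌊t/(k+1)⌋} + (1 − ε)^{t'})`.
* §4 `exists_sq_rk3CloverCharge_le` (`0 ≤ Q_m² ≤ M` uniformly) and **`twoArms_sq_rk3CloverCharge_sub_le`** — THE TWO ARMS MEASURE
  THE SAME SUSCEPTIBILITY: `|E^{HMC}_t[Q_m²] − E^{E1}_{t'}[Q_m²]| ≤ M((1 − δ)^{⌊t/(k+1)⌋} + (1 − ε)^{t'})`, both tending to `⟨Q_m²⟩_W`.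
* §5 OPEN BOUNDARIES (every `τ`; row 21's `OpenBoundaryHMCForce.obcForce_sunLeapfrogHMCN_uniformlyErgodic` and
  `WeightedOverrelaxation.obc_cmHeatBath_orSweep_uniformlyErgodic`): `obcHmcRun_integral_sub_le_of_mem_Icc`,
  `obcE1Run_integral_sub_le_of_mem_Icc`, **`twoArmsOBC_integral_sub_le_of_mem_Icc`** (slab energies, slab-charge correlators …).
NOT CLAIMED: the values of `k, δ, ε, M`; error bars at finite statistics; numbers.
-/

noncomputable section

namespace Summit.Ventures.LatticeQCDFlow.Exactness

open MeasureTheory ProbabilityTheory ProbabilityTheory.Kernel Set Function Filter Topology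
open Literature.MathematicalPhysics.QuantumFieldTheory
open Literature.MathematicalPhysics.QuantumLattice (fundamentalRep continuous_fundamentalRep cloverPseudoscalar
  continuous_cloverPseudoscalar measurable_cloverPseudoscalar exists_abs_cloverPseudoscalar_le)
open scoped ENNReal Matrix

set_option backward.isDefEq.respectTransparency false

/-! ## §1 Setwise closeness controls every bounded observable -/

section Bounded

variable {Ω : Type*} [MeasurableSpace Ω]

/-- **`|∫ g dμ − ∫ g dν| ≤ (b − a) δ`** for probability laws `δ`-close on every measurable set and every measurable `g` with
`a ≤ g ≤ b`. -/
theorem abs_integral_sub_integral_le_of_setwise_of_mem_Icc {μ ν : Measure Ω} [IsProbabilityMeasure μ] [IsProbabilityMeasure ν]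
    {δ : ℝ} (hδ : ∀ A, MeasurableSet A → |μ.real A - ν.real A| ≤ δ) {g : Ω → ℝ} (hg : Measurable g) {a b : ℝ}
    (ha : ∀ x, a ≤ g x) (hb : ∀ x, g x ≤ b) :
    |∫ x, g x ∂μ - ∫ x, g x ∂ν| ≤ (b - a) * δ := by
  have hδ0 : 0 ≤ δ := (abs_nonneg _).trans (hδ ∅ MeasurableSet.empty)
  rcases eq_or_lt_of_le (show a ≤ b from by
      rcases isEmpty_or_nonempty Ω with h | ⟨⟨x⟩⟩
      · exact le_of_eq (by
          have : (μ : Measure Ω) Set.univ = 1 := measure_univ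
          exact absurd this (by rw [Set.univ_eq_empty_iff.2 h, measure_empty]; exact zero_ne_one))
      · exact (ha x).trans (hb x)) with hab | hab
  · -- `a = b`: `g` is the constant `a`
    have hconst : g = fun _ => a := funext fun x => le_antisymm (hab ▸ hb x) (ha x)
    subst hconst
    simp only [MeasureTheory.integral_const, probReal_univ, smul_eq_mul, one_mul, sub_self, abs_zero]
    exact mul_nonneg (sub_nonneg.2 hab.le) hδ0
  · have hba : 0 < b - a := sub_pos.2 hab
    -- the rescaled observable `(g − a)/(b − a) ∈ [0,1]`
    have hint : ∀ (ρ : Measure Ω) [IsProbabilityMeasure ρ], Integrable g ρ := fun ρ _ =>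
      (integrable_const (max |a| |b|)).mono' hg.aestronglyMeasurable
        (ae_of_all _ fun x => by
          rw [Real.norm_eq_abs]
          exact abs_le_max_abs_abs (ha x) (hb x))
    have key := abs_integral_sub_integral_le_of_setwise hδ (g := fun x => (g x - a) / (b - a))
      ((hg.sub measurable_const).div_const _) (fun x => div_nonneg (sub_nonneg.2 (ha x)) hba.le)
      (fun x => (div_le_one hba).2 (sub_le_sub_right (hb x) a))
    have hμ : ∫ x, (g x - a) / (b - a) ∂μ = (∫ x, g x ∂μ - a) / (b - a) := by
      rw [integral_div, integral_sub (hint μ) (integrable_const a), MeasureTheory.integral_const, probReal_univ,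
        one_smul]
    have hν : ∫ x, (g x - a) / (b - a) ∂ν = (∫ x, g x ∂ν - a) / (b - a) := by
      rw [integral_div, integral_sub (hint ν) (integrable_const a), MeasureTheory.integral_const, probReal_univ,
        one_smul]
    rw [hμ, hν, ← sub_div, sub_sub_sub_cancel_right, abs_div, abs_of_pos hba, div_le_iff₀ hba] at key
    linarith [key]

end Bounded

/-! ## §2 Each arm: bounded observables converge to their Wilson expectation, geometrically -/

section Arms

variable (N : ℕ) [NeZero N] (d : ℕ) (β : ℝ)

/-- **HMC ARM, BOUNDED OBSERVABLES: `|E_t[g] − ⟨g⟩_W| ≤ (b − a)(1 − δ)^{⌊t/(k+1)⌋}`** for every probability start, every `t`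
and every measurable `g` with `a ≤ g ≤ b`, below the volume-uniform trajectory threshold. -/
theorem wilsonHmcRun_integral_sub_wilson_le_of_mem_Icc (L : ℕ) [NeZero L] {nstep : ℕ} {ε : ℝ} (hn : 1 ≤ nstep) (hε : 0 < ε)
    (hτ : nstep * ε ≤ sunWilsonTrajThreshold N d β) :
    ∃ k : ℕ, ∃ δ : ℝ, 0 < δ ∧ δ ≤ 1 ∧
      ∀ (μ₀ : Measure (GaugeConfig d L (Matrix.specialUnitaryGroup (Fin N) ℂ))) [IsProbabilityMeasure μ₀] (t : ℕ)
        {g : GaugeConfig d L (Matrix.specialUnitaryGroup (Fin N) ℂ) → ℝ} {a b : ℝ}, Measurable g → (∀ U, a ≤ g U) →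
        (∀ U, g U ≤ b) →
        |∫ U, g U ∂((fun m : Measure (GaugeConfig d L (Matrix.specialUnitaryGroup (Fin N) ℂ)) =>
              m.bind (sunLeapfrogHMCN (sunCoordι N) (sunCoordι_skew N) ε (Measure.addHaar : Measure (SUNCoords N))
                (sunKinetic N) (measurable_halfKick_sun N (measurable_sunWilsonForce N (d := d) (L := L) β) ε)
                (fun U => β * wilsonAction (suRep N) U) nstep))^[t] μ₀)
            - ∫ U, g U ∂(wilsonMeasure (d := d) (L := L) (suRep N) β)| ≤ (b - a) * (1 - δ) ^ (t / (k + 1)) := by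
  obtain ⟨k, δ, hδ, hδ1, h⟩ := wilsonForce_sunLeapfrogHMCN_uniformlyErgodic N d β L hn hε hτ
  refine ⟨k, δ, hδ, hδ1, fun μ₀ _ t g a b hg ha hb => ?_⟩
  haveI : IsMarkovKernel (sunLeapfrogHMCN (sunCoordι N) (sunCoordι_skew N) ε (Measure.addHaar : Measure (SUNCoords N))
      (sunKinetic N) (measurable_halfKick_sun N (measurable_sunWilsonForce N (d := d) (L := L) β) ε)
      (fun U => β * wilsonAction (suRep N) U) nstep) := by
    haveI : Fact (Measurable fun z : GaugeConfig d L (Matrix.specialUnitaryGroup (Fin N) ℂ) × (Edge d L → SUNCoords N) =>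
        β * wilsonAction (suRep N) z.1 + sunKinetic N z.2) :=
      ⟨((continuous_smul_wilsonAction (suRep N) continuous_suRep β).measurable.comp measurable_fst).add
        ((measurable_sunKinetic N).comp measurable_snd)⟩
    haveI := isProbabilityMeasure_sunMomentumLaw (L := Edge d L) (Measure.addHaar : Measure (SUNCoords N)) (sunKinetic N)
      (measurable_sunKinetic N) (sunMomentumWeight_sunKinetic_ne_top N Measure.addHaar)
    unfold sunLeapfrogHMCN; infer_instance
  haveI := isProbabilityMeasure_iterate_bind (κ := sunLeapfrogHMCN (sunCoordι N) (sunCoordι_skew N) ε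
    (Measure.addHaar : Measure (SUNCoords N)) (sunKinetic N)
    (measurable_halfKick_sun N (measurable_sunWilsonForce N (d := d) (L := L) β) ε) (fun U => β * wilsonAction (suRep N) U) nstep) μ₀ t
  haveI := isProbabilityMeasure_wilsonMeasure (d := d) (L := L) (suRep N) continuous_suRep β
  exact abs_integral_sub_integral_le_of_setwise_of_mem_Icc (fun A _ => h μ₀ t A) hg ha hb

variable {m : Type*} [Fintype m] [DecidableEq m]

/-- **E1 ARM, BOUNDED OBSERVABLES: `|E_t[g] − ⟨g⟩_W| ≤ (b − a)(1 − ε)^t`** for every probability start, every `t` and every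
measurable `g` with `a ≤ g ≤ b` (`L ≥ 2`; one Cabibbo–Marinari heat-bath sweep in lexicographic or reversed subgroup order
visiting every link, then any OR schedule). -/
theorem e1Run_integral_sub_wilson_le_of_mem_Icc (L : ℕ) [NeZero L] (hL : 2 ≤ L) (frames : List (Fin N ≃ Fin 2 ⊕ m))
    (hlex : frames.map pairOf = lexPairs (Finset.univ.sort (· ≤ ·) : List (Fin N)) ∨
      frames.map pairOf = (lexPairs (Finset.univ.sort (· ≤ ·) : List (Fin N))).reverse)
    {links : List (Edge d L)} (hl : ∀ l, l ∈ links) (sched : List (Edge d L × (Fin N ≃ Fin 2 ⊕ m))) :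
    ∃ ε : ℝ, 0 < ε ∧ ∀ (μ₀ : Measure (GaugeConfig d L (Matrix.specialUnitaryGroup (Fin N) ℂ))) [IsProbabilityMeasure μ₀]
      (t : ℕ) {g : GaugeConfig d L (Matrix.specialUnitaryGroup (Fin N) ℂ) → ℝ} {a b : ℝ}, Measurable g → (∀ U, a ≤ g U) →
      (∀ U, g U ≤ b) →
      |∫ U, g U ∂((fun ν : Measure (GaugeConfig d L (Matrix.specialUnitaryGroup (Fin N) ℂ)) =>
            ν.bind (cmORSweep sched ∘ₖ latSweep (gibbsDensity fun U => β * wilsonAction (suRep N) U) frames links))^[t] μ₀)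
          - ∫ U, g U ∂(wilsonMeasure (suRep N) β)| ≤ (b - a) * (1 - ε) ^ t := by
  obtain ⟨ε, hε, h⟩ := wilson_cmHeatBath_orSweep_uniformlyErgodic (d := d) (N := N) β hL frames hlex hl sched
  refine ⟨ε, hε, fun μ₀ _ t g a b hg ha hb => ?_⟩
  -- the E1 composite is Markov (as in row 21's `TwoArmsAgreement`)
  have hS : Continuous fun U : GaugeConfig d L (Matrix.specialUnitaryGroup (Fin N) ℂ) =>
      β * wilsonAction (suRep N) U := continuous_smul_wilsonAction (suRep N) continuous_suRep β
  obtain ⟨ωa, -, hmin⟩ := isCompact_univ.exists_isMinOn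
    (Set.univ_nonempty (α := GaugeConfig d L (Matrix.specialUnitaryGroup (Fin N) ℂ))) hS.continuousOn
  obtain ⟨ωb, -, hmax⟩ := isCompact_univ.exists_isMaxOn
    (Set.univ_nonempty (α := GaugeConfig d L (Matrix.specialUnitaryGroup (Fin N) ℂ))) hS.continuousOn
  have hωa : ∀ ω, β * wilsonAction (suRep N) ωa ≤ β * wilsonAction (suRep N) ω := fun ω =>
    (isMinOn_iff.1 hmin) ω (Set.mem_univ ω)
  have hωb : ∀ ω, β * wilsonAction (suRep N) ω ≤ β * wilsonAction (suRep N) ωb := fun ω =>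
    (isMaxOn_iff.1 hmax) ω (Set.mem_univ ω)
  have hm0 : ENNReal.ofReal (Real.exp (-(β * wilsonAction (suRep N) ωb))) ≠ 0 := by
    rw [Ne, ENNReal.ofReal_eq_zero, not_le]; exact Real.exp_pos _
  haveI := isMarkovKernel_latSweep (measurable_gibbsDensity hS) hm0 ENNReal.ofReal_ne_top
    (fun ω => (gibbsDensity_bounds hωa hωb ω).1) (fun ω => (gibbsDensity_bounds hωa hωb ω).2) frames links
  haveI := isProbabilityMeasure_iterate_bind
    (κ := cmORSweep sched ∘ₖ latSweep (gibbsDensity fun U => β * wilsonAction (suRep N) U) frames links) μ₀ t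
  haveI := isProbabilityMeasure_wilsonMeasure (d := d) (L := L) (suRep N) continuous_suRep β
  exact abs_integral_sub_integral_le_of_setwise_of_mem_Icc (fun A _ => h μ₀ t A) hg ha hb

/-! ## §3 The two arms agree on every bounded observable -/

/-- **`|E^{HMC}_t[g] − E^{E1}_{t'}[g]| ≤ (b − a)((1 − δ)^{⌊t/(k+1)⌋} + (1 − ε')^{t'})`** for every measurable `a ≤ g ≤ b`, all
probability starts, all steps. -/
theorem twoArms_integral_sub_le_of_mem_Icc (L : ℕ) [NeZero L] (hL : 2 ≤ L) {nstep : ℕ} {ε : ℝ} (hn : 1 ≤ nstep) (hε : 0 < ε)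
    (hτ : nstep * ε ≤ sunWilsonTrajThreshold N d β) (frames : List (Fin N ≃ Fin 2 ⊕ m))
    (hlex : frames.map pairOf = lexPairs (Finset.univ.sort (· ≤ ·) : List (Fin N)) ∨
      frames.map pairOf = (lexPairs (Finset.univ.sort (· ≤ ·) : List (Fin N))).reverse)
    {links : List (Edge d L)} (hl : ∀ l, l ∈ links) (sched : List (Edge d L × (Fin N ≃ Fin 2 ⊕ m))) :
    ∃ k : ℕ, ∃ δ : ℝ, ∃ ε' : ℝ, 0 < δ ∧ δ ≤ 1 ∧ 0 < ε' ∧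
      ∀ (μ₀ μ₀' : Measure (GaugeConfig d L (Matrix.specialUnitaryGroup (Fin N) ℂ))) [IsProbabilityMeasure μ₀]
        [IsProbabilityMeasure μ₀'] (t t' : ℕ) {g : GaugeConfig d L (Matrix.specialUnitaryGroup (Fin N) ℂ) → ℝ} {a b : ℝ},
        Measurable g → (∀ U, a ≤ g U) → (∀ U, g U ≤ b) →
        |∫ U, g U ∂((fun ν : Measure (GaugeConfig d L (Matrix.specialUnitaryGroup (Fin N) ℂ)) =>
              ν.bind (sunLeapfrogHMCN (sunCoordι N) (sunCoordι_skew N) ε (Measure.addHaar : Measure (SUNCoords N))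
                (sunKinetic N) (measurable_halfKick_sun N (measurable_sunWilsonForce N (d := d) (L := L) β) ε)
                (fun U => β * wilsonAction (suRep N) U) nstep))^[t] μ₀)
          - ∫ U, g U ∂((fun ν : Measure (GaugeConfig d L (Matrix.specialUnitaryGroup (Fin N) ℂ)) =>
              ν.bind (cmORSweep sched ∘ₖ latSweep (gibbsDensity fun U => β * wilsonAction (suRep N) U) frames links))^[t'] μ₀')|
          ≤ (b - a) * ((1 - δ) ^ (t / (k + 1)) + (1 - ε') ^ t') := by
  obtain ⟨k, δ, hδ, hδ1, hH⟩ := wilsonHmcRun_integral_sub_wilson_le_of_mem_Icc N d β L hn hε hτ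
  obtain ⟨ε', hε', hE⟩ := e1Run_integral_sub_wilson_le_of_mem_Icc N d β L hL frames hlex hl sched
  refine ⟨k, δ, ε', hδ, hδ1, hε', fun μ₀ μ₀' _ _ t t' g a b hg ha hb => ?_⟩
  have h1' := hH μ₀ t hg ha hb
  have h2' := hE μ₀' t' hg ha hb
  rw [abs_sub_comm] at h2'
  rw [mul_add]
  exact (abs_sub_le _ _ _).trans (add_le_add h1' h2')

end Arms

/-! ## §4 The measured topological susceptibility -/

section Susceptibility

variable (N : ℕ) [NeZero N] (β : ℝ)

omit [NeZero N] in
/-- **`0 ≤ Q_m² ≤ M`** uniformly: the square of the measured charge `Q_m = Σ_x P_x ∘ RK3_{ε'}^m` is bounded on the (compact)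
configuration space. -/
theorem exists_sq_rk3CloverCharge_le (L : ℕ) [NeZero L] (ε' : ℝ) (m : ℕ) :
    ∃ M : ℝ, ∀ U : GaugeConfig 4 L (Matrix.specialUnitaryGroup (Fin N) ℂ),
      (∑ x : Site 4 L, cloverPseudoscalar (fundamentalRep (Fin N)) x ((Scoring.wilsonFlowRK3 (n := N) ε')^[m] U)) ^ 2 ≤ M := by
  choose C hC using fun x : Site 4 L =>
    exists_abs_cloverPseudoscalar_le (ρ := fundamentalRep (Fin N)) (continuous_fundamentalRep (Fin N)) x
  refine ⟨(∑ x : Site 4 L, C x) ^ 2, fun U => ?_⟩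
  have hle : |∑ x : Site 4 L, cloverPseudoscalar (fundamentalRep (Fin N)) x ((Scoring.wilsonFlowRK3 (n := N) ε')^[m] U)| ≤ ∑ x, C x :=
    (Finset.abs_sum_le_sum_abs _ _).trans (Finset.sum_le_sum fun x _ => hC x _)
  calc (∑ x : Site 4 L, cloverPseudoscalar (fundamentalRep (Fin N)) x ((Scoring.wilsonFlowRK3 (n := N) ε')^[m] U)) ^ 2
      = |∑ x : Site 4 L, cloverPseudoscalar (fundamentalRep (Fin N)) x ((Scoring.wilsonFlowRK3 (n := N) ε')^[m] U)| ^ 2 := (sq_abs _).symm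
    _ ≤ (∑ x, C x) ^ 2 := pow_le_pow_left₀ (abs_nonneg _) hle 2

variable {m : Type*} [Fintype m] [DecidableEq m]

/-- **THE TWO ARMS MEASURE THE SAME SUSCEPTIBILITY, WITH RATES**: for the square of the measured charge at any flow depth,
`|E^{HMC}_t[Q_m²] − E^{E1}_{t'}[Q_m²]| ≤ M((1 − δ)^{⌊t/(k+1)⌋} + (1 − ε')^{t'})` for all probability starts and all steps
(`SU(N)`, `d = 4`, HMC below the trajectory threshold, E1 as in §2). -/
theorem twoArms_sq_rk3CloverCharge_sub_le (L : ℕ) [NeZero L] (hL : 2 ≤ L) {nstep : ℕ} {ε : ℝ} (hn : 1 ≤ nstep) (hε : 0 < ε)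
    (hτ : nstep * ε ≤ sunWilsonTrajThreshold N 4 β) (frames : List (Fin N ≃ Fin 2 ⊕ m))
    (hlex : frames.map pairOf = lexPairs (Finset.univ.sort (· ≤ ·) : List (Fin N)) ∨
      frames.map pairOf = (lexPairs (Finset.univ.sort (· ≤ ·) : List (Fin N))).reverse)
    {links : List (Edge 4 L)} (hl : ∀ l, l ∈ links) (sched : List (Edge 4 L × (Fin N ≃ Fin 2 ⊕ m))) (ε' : ℝ) (mf : ℕ) :
    ∃ M : ℝ, ∃ k : ℕ, ∃ δ : ℝ, ∃ ε'' : ℝ, 0 < δ ∧ δ ≤ 1 ∧ 0 < ε'' ∧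
      ∀ (μ₀ μ₀' : Measure (GaugeConfig 4 L (Matrix.specialUnitaryGroup (Fin N) ℂ))) [IsProbabilityMeasure μ₀]
        [IsProbabilityMeasure μ₀'] (t t' : ℕ),
        |∫ U, (∑ x : Site 4 L, cloverPseudoscalar (fundamentalRep (Fin N)) x ((Scoring.wilsonFlowRK3 (n := N) ε')^[mf] U)) ^ 2
            ∂((fun ν : Measure (GaugeConfig 4 L (Matrix.specialUnitaryGroup (Fin N) ℂ)) =>
              ν.bind (sunLeapfrogHMCN (sunCoordι N) (sunCoordι_skew N) ε (Measure.addHaar : Measure (SUNCoords N))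
                (sunKinetic N) (measurable_halfKick_sun N (measurable_sunWilsonForce N (d := 4) (L := L) β) ε)
                (fun U => β * wilsonAction (suRep N) U) nstep))^[t] μ₀)
          - ∫ U, (∑ x : Site 4 L, cloverPseudoscalar (fundamentalRep (Fin N)) x ((Scoring.wilsonFlowRK3 (n := N) ε')^[mf] U)) ^ 2
            ∂((fun ν : Measure (GaugeConfig 4 L (Matrix.specialUnitaryGroup (Fin N) ℂ)) =>
              ν.bind (cmORSweep sched ∘ₖ latSweep (gibbsDensity fun U => β * wilsonAction (suRep N) U) frames links))^[t'] μ₀')|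
          ≤ M * ((1 - δ) ^ (t / (k + 1)) + (1 - ε'') ^ t') := by
  obtain ⟨M, hM⟩ := exists_sq_rk3CloverCharge_le N L ε' mf
  obtain ⟨k, δ, ε'', hδ, hδ1, hε'', h⟩ := twoArms_integral_sub_le_of_mem_Icc N 4 β L hL hn hε hτ frames hlex hl sched
  refine ⟨M, k, δ, ε'', hδ, hδ1, hε'', fun μ₀ μ₀' _ _ t t' => ?_⟩
  have hmeas : Measurable fun U : GaugeConfig 4 L (Matrix.specialUnitaryGroup (Fin N) ℂ) =>
      (∑ x : Site 4 L, cloverPseudoscalar (fundamentalRep (Fin N)) x ((Scoring.wilsonFlowRK3 (n := N) ε')^[mf] U)) ^ 2 :=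
    (Finset.measurable_sum _ fun x _ => (measurable_cloverPseudoscalar (fundamentalRep (Fin N))
      (continuous_fundamentalRep (Fin N)) x).comp ((Scoring.continuous_wilsonFlowRK3 (n := N) ε').measurable.iterate mf)).pow_const 2
  have key := h μ₀ μ₀' t t' hmeas (fun U => sq_nonneg _) hM
  rw [sub_zero] at key
  exact key

end Susceptibility

/-! ## §5 The same with open boundaries -/

section OBC

variable (N : ℕ) [NeZero N] (d : ℕ) (β : ℝ)

/-- **OBC HMC ARM, BOUNDED OBSERVABLES: `|E_t[g] − ⟨g⟩_OBC| ≤ (b − a)(1 − δ)^{⌊t/(k+1)⌋}`** (every open direction `τ`). -/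
theorem obcHmcRun_integral_sub_le_of_mem_Icc (τ : Fin d) (L : ℕ) [NeZero L] {nstep : ℕ} {ε : ℝ} (hn : 1 ≤ nstep) (hε : 0 < ε)
    (hτ : nstep * ε ≤ sunWilsonTrajThreshold N d β) :
    ∃ k : ℕ, ∃ δ : ℝ, 0 < δ ∧ δ ≤ 1 ∧
      ∀ (μ₀ : Measure (GaugeConfig d L (Matrix.specialUnitaryGroup (Fin N) ℂ))) [IsProbabilityMeasure μ₀] (t : ℕ)
        {g : GaugeConfig d L (Matrix.specialUnitaryGroup (Fin N) ℂ) → ℝ} {a b : ℝ}, Measurable g → (∀ U, a ≤ g U) →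
        (∀ U, g U ≤ b) →
        |∫ U, g U ∂((fun m : Measure (GaugeConfig d L (Matrix.specialUnitaryGroup (Fin N) ℂ)) =>
              m.bind (sunLeapfrogHMCN (sunCoordι N) (sunCoordι_skew N) ε (Measure.addHaar : Measure (SUNCoords N))
                (sunKinetic N) (measurable_halfKick_sun N (measurable_sunWeightedForce N (d := d) (L := L) (obcWeight τ) β) ε)
                (fun U => β * obcAction (suRep N) τ U) nstep))^[t] μ₀)
            - ∫ U, g U ∂(gibbsProbability (Measure.pi fun _ : Edge d L => haarProbability (Matrix.specialUnitaryGroup (Fin N) ℂ))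
                (fun U => Real.exp (-(β * obcAction (suRep N) τ U))))| ≤ (b - a) * (1 - δ) ^ (t / (k + 1)) := by
  obtain ⟨k, δ, hδ, hδ1, h⟩ := obcForce_sunLeapfrogHMCN_uniformlyErgodic N d β τ L hn hε hτ
  refine ⟨k, δ, hδ, hδ1, fun μ₀ _ t g a b hg ha hb => ?_⟩
  haveI : IsMarkovKernel (sunLeapfrogHMCN (sunCoordι N) (sunCoordι_skew N) ε (Measure.addHaar : Measure (SUNCoords N))
      (sunKinetic N) (measurable_halfKick_sun N (measurable_sunWeightedForce N (d := d) (L := L) (obcWeight τ) β) ε)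
      (fun U => β * obcAction (suRep N) τ U) nstep) := by
    haveI : Fact (Measurable fun z : GaugeConfig d L (Matrix.specialUnitaryGroup (Fin N) ℂ) × (Edge d L → SUNCoords N) =>
        β * obcAction (suRep N) τ z.1 + sunKinetic N z.2) :=
      ⟨(((continuous_obcAction (suRep N) continuous_suRep τ).measurable.const_mul β).comp measurable_fst).add
        ((measurable_sunKinetic N).comp measurable_snd)⟩
    haveI := isProbabilityMeasure_sunMomentumLaw (L := Edge d L) (Measure.addHaar : Measure (SUNCoords N)) (sunKinetic N)
      (measurable_sunKinetic N) (sunMomentumWeight_sunKinetic_ne_top N Measure.addHaar)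
    unfold sunLeapfrogHMCN; infer_instance
  haveI := isProbabilityMeasure_iterate_bind (κ := sunLeapfrogHMCN (sunCoordι N) (sunCoordι_skew N) ε
    (Measure.addHaar : Measure (SUNCoords N)) (sunKinetic N)
    (measurable_halfKick_sun N (measurable_sunWeightedForce N (d := d) (L := L) (obcWeight τ) β) ε)
    (fun U => β * obcAction (suRep N) τ U) nstep) μ₀ t
  haveI := isProbabilityMeasure_obcGibbs (d := d) (L := L) (suRep N) continuous_suRep τ β
  exact abs_integral_sub_integral_le_of_setwise_of_mem_Icc (fun A _ => h μ₀ t A) hg ha hb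

variable {m : Type*} [Fintype m] [DecidableEq m]

/-- **OBC E1 ARM, BOUNDED OBSERVABLES: `|E_t[g] − ⟨g⟩_OBC| ≤ (b − a)(1 − ε)^t`** (CM heat bath for `e^{−βS_OBC}` then any
open-boundary-weighted OR schedule; `L ≥ 2`). -/
theorem obcE1Run_integral_sub_le_of_mem_Icc (τ : Fin d) (L : ℕ) [NeZero L] (hL : 2 ≤ L) (frames : List (Fin N ≃ Fin 2 ⊕ m))
    (hlex : frames.map pairOf = lexPairs (Finset.univ.sort (· ≤ ·) : List (Fin N)) ∨
      frames.map pairOf = (lexPairs (Finset.univ.sort (· ≤ ·) : List (Fin N))).reverse)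
    {links : List (Edge d L)} (hl : ∀ l, l ∈ links) (sched : List (Edge d L × (Fin N ≃ Fin 2 ⊕ m))) :
    ∃ ε : ℝ, 0 < ε ∧ ∀ (μ₀ : Measure (GaugeConfig d L (Matrix.specialUnitaryGroup (Fin N) ℂ))) [IsProbabilityMeasure μ₀]
      (t : ℕ) {g : GaugeConfig d L (Matrix.specialUnitaryGroup (Fin N) ℂ) → ℝ} {a b : ℝ}, Measurable g → (∀ U, a ≤ g U) →
      (∀ U, g U ≤ b) →
      |∫ U, g U ∂((fun ν : Measure (GaugeConfig d L (Matrix.specialUnitaryGroup (Fin N) ℂ)) =>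
            ν.bind (cmORSweepW (obcWeight τ) sched ∘ₖ latSweep (gibbsDensity fun U => β * obcAction (suRep N) τ U) frames links))^[t] μ₀)
          - ∫ U, g U ∂(gibbsProbability (Measure.pi fun _ : Edge d L => haarProbability (Matrix.specialUnitaryGroup (Fin N) ℂ))
              (fun U => Real.exp (-(β * obcAction (suRep N) τ U))))| ≤ (b - a) * (1 - ε) ^ t := by
  obtain ⟨ε, hε, h⟩ := obc_cmHeatBath_orSweep_uniformlyErgodic (d := d) (N := N) β hL τ frames hlex hl sched
  refine ⟨ε, hε, fun μ₀ _ t g a b hg ha hb => ?_⟩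
  have hS : Continuous fun U : GaugeConfig d L (Matrix.specialUnitaryGroup (Fin N) ℂ) => β * obcAction (suRep N) τ U :=
    (continuous_obcAction (suRep N) continuous_suRep τ).const_smul β
  obtain ⟨ωa, -, hmin⟩ := isCompact_univ.exists_isMinOn
    (Set.univ_nonempty (α := GaugeConfig d L (Matrix.specialUnitaryGroup (Fin N) ℂ))) hS.continuousOn
  obtain ⟨ωb, -, hmax⟩ := isCompact_univ.exists_isMaxOn
    (Set.univ_nonempty (α := GaugeConfig d L (Matrix.specialUnitaryGroup (Fin N) ℂ))) hS.continuousOn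
  have hωa : ∀ ω, β * obcAction (suRep N) τ ωa ≤ β * obcAction (suRep N) τ ω := fun ω => (isMinOn_iff.1 hmin) ω (Set.mem_univ ω)
  have hωb : ∀ ω, β * obcAction (suRep N) τ ω ≤ β * obcAction (suRep N) τ ωb := fun ω => (isMaxOn_iff.1 hmax) ω (Set.mem_univ ω)
  have hm0 : ENNReal.ofReal (Real.exp (-(β * obcAction (suRep N) τ ωb))) ≠ 0 := by
    rw [Ne, ENNReal.ofReal_eq_zero, not_le]; exact Real.exp_pos _
  haveI := isMarkovKernel_latSweep (measurable_gibbsDensity hS) hm0 ENNReal.ofReal_ne_top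
    (fun ω => (gibbsDensity_bounds hωa hωb ω).1) (fun ω => (gibbsDensity_bounds hωa hωb ω).2) frames links
  haveI := isProbabilityMeasure_iterate_bind
    (κ := cmORSweepW (obcWeight τ) sched ∘ₖ latSweep (gibbsDensity fun U => β * obcAction (suRep N) τ U) frames links) μ₀ t
  haveI := isProbabilityMeasure_obcGibbs (d := d) (L := L) (suRep N) continuous_suRep τ β
  -- the two spellings of the open-boundary Gibbs law agree (row 21's `TwoArmsAgreement.gibbsProbability_pi_eq_piGibbsLaw`)
  have hlaw : ∀ S : GaugeConfig d L (Matrix.specialUnitaryGroup (Fin N) ℂ) → ℝ,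
      gibbsProbability (Measure.pi fun _ : Edge d L => haarProbability (Matrix.specialUnitaryGroup (Fin N) ℂ))
          (fun U => Real.exp (-(S U))) = piGibbsLaw (linkHaar (Edge d L) (Fin N)) (gibbsDensity S) := fun S => by
    unfold gibbsProbability piGibbsLaw gibbsDensity linkHaar
    rw [withDensity_apply _ MeasurableSet.univ, Measure.restrict_univ]
  rw [hlaw]
  rw [hlaw] at *
  exact abs_integral_sub_integral_le_of_setwise_of_mem_Icc (fun A _ => h μ₀ t A) hg ha hb

/-- **THE TWO OPEN-BOUNDARY ARMS AGREE ON EVERY BOUNDED OBSERVABLE, WITH RATES** — e.g. the slab-charge correlators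
`Q_s Q_{s'}` and slab energies of the open-boundary side-run. -/
theorem twoArmsOBC_integral_sub_le_of_mem_Icc (τ : Fin d) (L : ℕ) [NeZero L] (hL : 2 ≤ L) {nstep : ℕ} {ε : ℝ} (hn : 1 ≤ nstep)
    (hε : 0 < ε) (hτ : nstep * ε ≤ sunWilsonTrajThreshold N d β) (frames : List (Fin N ≃ Fin 2 ⊕ m))
    (hlex : frames.map pairOf = lexPairs (Finset.univ.sort (· ≤ ·) : List (Fin N)) ∨
      frames.map pairOf = (lexPairs (Finset.univ.sort (· ≤ ·) : List (Fin N))).reverse)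
    {links : List (Edge d L)} (hl : ∀ l, l ∈ links) (sched : List (Edge d L × (Fin N ≃ Fin 2 ⊕ m))) :
    ∃ k : ℕ, ∃ δ : ℝ, ∃ ε' : ℝ, 0 < δ ∧ δ ≤ 1 ∧ 0 < ε' ∧
      ∀ (μ₀ μ₀' : Measure (GaugeConfig d L (Matrix.specialUnitaryGroup (Fin N) ℂ))) [IsProbabilityMeasure μ₀]
        [IsProbabilityMeasure μ₀'] (t t' : ℕ) {g : GaugeConfig d L (Matrix.specialUnitaryGroup (Fin N) ℂ) → ℝ} {a b : ℝ},
        Measurable g → (∀ U, a ≤ g U) → (∀ U, g U ≤ b) →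
        |∫ U, g U ∂((fun ν : Measure (GaugeConfig d L (Matrix.specialUnitaryGroup (Fin N) ℂ)) =>
              ν.bind (sunLeapfrogHMCN (sunCoordι N) (sunCoordι_skew N) ε (Measure.addHaar : Measure (SUNCoords N))
                (sunKinetic N) (measurable_halfKick_sun N (measurable_sunWeightedForce N (d := d) (L := L) (obcWeight τ) β) ε)
                (fun U => β * obcAction (suRep N) τ U) nstep))^[t] μ₀)
          - ∫ U, g U ∂((fun ν : Measure (GaugeConfig d L (Matrix.specialUnitaryGroup (Fin N) ℂ)) =>
              ν.bind (cmORSweepW (obcWeight τ) sched ∘ₖ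
                latSweep (gibbsDensity fun U => β * obcAction (suRep N) τ U) frames links))^[t'] μ₀')|
          ≤ (b - a) * ((1 - δ) ^ (t / (k + 1)) + (1 - ε') ^ t') := by
  obtain ⟨k, δ, hδ, hδ1, hH⟩ := obcHmcRun_integral_sub_le_of_mem_Icc N d β τ L hn hε hτ
  obtain ⟨ε', hε', hE⟩ := obcE1Run_integral_sub_le_of_mem_Icc N d β τ L hL frames hlex hl sched
  refine ⟨k, δ, ε', hδ, hδ1, hε', fun μ₀ μ₀' _ _ t t' g a b hg ha hb => ?_⟩
  have h1' := hH μ₀ t hg ha hb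
  have h2' := hE μ₀' t' hg ha hb
  rw [abs_sub_comm] at h2'
  rw [mul_add]
  exact (abs_sub_le _ _ _).trans (add_le_add h1' h2')

end OBC

end Summit.Ventures.LatticeQCDFlow.Exactness
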